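import Summits.HodgeConjecture.CorCM.ParallelShadowsCMFieldsHodge
import Summits.HodgeConjecture.CorCM.QuarticCMSubfieldOfOcticHodge
import Literature.AlgebraicGeometry.Pohlmann1968.SimpleCMAbelianVarietyPowersDivisorGenerated
import HarnessLib

/-!
# Two CM fields QUADRATIC over a common subfield, types unsplit over the SAME place: the pair is degenerate — two
# simple CM abelian fourfolds whose octic fields contain a common quartic CM field carry exceptional Hodge classes on
# some `F₀^a × F₁^b` as soon as their types are unsplit over the same place

COR-CM (cell `pub-hodgecm2`, binder seat `b16` gen 49, count-neutral claim PARSHADOW, file F3 — the first file of the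
`(4,4)` cell named as successor in the seat's CM34 / PTCONJ cards; theorems only, no definition, no named fact, no
`sorry`).  NEW as stated, hence under `Summits/`.  HONEST FRAMING: rank statements and EXCEPTIONAL (outside `D• ⊗ ℂ`)
Hodge classes on products of CM abelian varieties, not claimed algebraic or not; `HC_CM` is neither used nor asserted.

SETTING.  A number field `k` received by two CM fields `K_{i₀}`, `K_{i₁}` which are QUADRATIC over it
(`[K_{i_k} : ℚ] = 2 [k : ℚ]`; then `k` is a CM field or totally real, and every place `z : k → ℂ` has exactly two
extensions to `K_{i_k}`, `card_filter_comp_eq_two`).  A place `z` is UNSPLIT for `Φ_{i_k}` when its two extensions lie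
on the same side of `Φ_{i_k}` (the tree's hypothesis shape of `QuarticCMReflexInOcticHodge.exists_fibre_subset_of_unsplit`),
SPLIT otherwise; unsplit places come in conjugate pairs `{z, z̄}`, with both extensions of `z` inside and both of `z̄`
outside the type (or conversely).  The shadow of file F2 is `±2` at an unsplit place and `0` at a split one.

> **Theorem** (`not_isNondegenerateFamily_of_common_unsplit_place`).  If some place `z₀` of `k` is unsplit for BOTH
> `Φ_{i₀}` and `Φ_{i₁}` while every place outside `{z₀, z̄₀}` is split for both, the family `Φ` is DEGENERATE:
> `cmFamilyRank Φ + |I| < Σ_i cmTypeRank Φ_i + 1`; the reflex fields of `(K_{i₀}, Φ_{i₀})`, `(K_{i₁}, Φ_{i₁})` do not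
> meet in a totally real field (`not_exists_smul_eq_conj_of_common_unsplit_place`); and SIMPLE, NON-ISOGENOUS
> realisations carry an exceptional Hodge class on some `A_{i₀}^a × A_{i₁}^b`
> (`exists_exceptional_prod_of_isSimple_of_common_unsplit_place`).

THE `(4,4)` CELL (`exists_exceptional_prod_fourfolds_of_common_unsplit_place`).  `k` a QUARTIC CM field (cyclic,
biquadratic or non-Galois), `K_{i₀}, K_{i₁} ⊇ k` octic, `F₀, F₁` SIMPLE CM abelian fourfolds realising `Φ_{i₀}, Φ_{i₁}`,
not isogenous.  A primitive octic type over a quartic CM subfield has exactly one unsplit conjugate pair (Kubota; the two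
other patterns are the types induced from `k` and the types with zero shadow, both of rank `≤ 4`); if the unsplit pairs
of `Φ_{i₀}` and `Φ_{i₁}` COINCIDE, some `F₀^a × F₁^b` carries an exceptional Hodge class — whatever else is true of the
fields.  For `k` cyclic or biquadratic this is contained in the tree (`CommonAbelianCMSubfieldDegenerate`,
`SharedImaginaryQuadraticDegenerate`: there EVERY pair of nondegenerate types is jointly degenerate); for `k` NON-GALOIS
quartic it is new and TYPE-DEPENDENT, the `(4,4)` analogue of the `(2,4)` reflex dichotomy `QuarticCMReflexInOcticHodge`:
when the unsplit pairs DIFFER the pair is additive as soon as the two reflex fields meet in a totally real field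
(`ReflexFieldsMeetRealCMHodge.hodgeConjectureFor_prod_of_fixingFields_inf_real`; numerically — 85 Galois sign-models
`D₄ ⋉ (ℤ/2)^4` of two octic CM fields over one non-Galois quartic CM field, seat folder `shadow44d.py` — different unsplit
pairs are additive in 1632 of 1952 nondegenerate type pairs and exactly when the stabiliser closure contains complex
conjugation; same unsplit pair: additive in 0 of 2720).

## References

* [Gordon1999HodgeAVSurvey] B. B. Gordon, *A survey of the Hodge conjecture for abelian varieties*, 7.4–7.7, 9.4.3.
* [MoonenZarhin1999LowDim] B. Moonen, Yu. Zarhin, *Hodge classes on abelian varieties of low dimension*, Math. Ann. 315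
  (1999) ("Hodge groups of simple abelian surfaces of CM-type": the dihedral quartic case one dimension down).
* [Shimura1998] G. Shimura, *Abelian Varieties with Complex Multiplication and Modular Functions*, §8.3, §8.4 (2)(C), §18.1.
* [Kubota1965] T. Kubota, *On the field extension by complex multiplication*, Trans. AMS 118 (1965), §2.
-/

set_option autoImplicit false

noncomputable section

open scoped BigOperators
open CategoryTheory CategoryTheory.Limits NumberField NumberField.ComplexEmbedding Module

namespace Summit.HodgeConjecture.CorCM

open Literature.NumberTheory.ComplexMultiplication
open Literature.AlgebraicGeometry.Motives (AbelianVariety CMType)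
open Literature.AlgebraicGeometry.HodgeTheory
open Literature.AlgebraicGeometry.ComplexMultiplication (IsCMTypeRealisation)
open Literature.AlgebraicGeometry.VanGeemen1994 (hodgeClassSpan)
open Literature.AlgebraicGeometry.Pohlmann1968
open Literature.Barriers.HodgeConjecture (divisorClassesSpan)
open scoped Classical

/-! ### §1 Quadratic steps: fibres of two, unsplit and split places, the shadow -/

section QuadraticStep

variable {k K : Type} [Field k] [NumberField k] [Field K] [NumberField K]

/-- Over a quadratic step every place has exactly TWO extensions: `#{φ | φ ∘ e = z} = 2` when `[K:ℚ] = 2[k:ℚ]`.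
[cite: Shimura1998, §18.1] -/
theorem card_filter_comp_eq_two (e : k →+* K) (h2 : finrank ℚ K = 2 * finrank ℚ k) (z : k →+* ℂ) :
    (Finset.univ.filter fun φ : K →+* ℂ => φ.comp e = z).card = 2 := by
  have h := card_filter_comp_eq_mul_finrank e z
  rw [h2] at h
  have hk : 0 < finrank ℚ k := finrank_pos
  exact Nat.eq_of_mul_eq_mul_right hk h

/-- `#{φ ∈ Φ | φ ∘ e = z} ≤ 2` over a quadratic step. [cite: Shimura1998, §18.1] -/
theorem card_filter_comp_mem_le_two (e : k →+* K) (h2 : finrank ℚ K = 2 * finrank ℚ k) (Φ : CMType K)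
    (z : k →+* ℂ) : (Finset.univ.filter fun φ : K →+* ℂ => φ.comp e = z ∧ φ ∈ Φ.1).card ≤ 2 := by
  rw [← card_filter_comp_eq_two e h2 z]
  exact Finset.card_le_card (Finset.monotone_filter_right _ fun φ _ h => h.1)

/-- **An UNSPLIT place has signature `0` or `2`**: if the two extensions of `z` lie on the same side of `Φ` then
`#{φ ∈ Φ | φ ∘ e = z} ∈ {0, 2}`. [cite: Shimura1998, §18.1] -/
theorem card_filter_comp_mem_of_unsplit (e : k →+* K) (h2 : finrank ℚ K = 2 * finrank ℚ k) (Φ : CMType K)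
    {z : k →+* ℂ} (hz : ∀ y y' : K →+* ℂ, y.comp e = z → y'.comp e = z → (y ∈ Φ.1 ↔ y' ∈ Φ.1)) :
    (Finset.univ.filter fun φ : K →+* ℂ => φ.comp e = z ∧ φ ∈ Φ.1).card = 0 ∨
      (Finset.univ.filter fun φ : K →+* ℂ => φ.comp e = z ∧ φ ∈ Φ.1).card = 2 := by
  by_cases hex : ∃ y : K →+* ℂ, y.comp e = z ∧ y ∈ Φ.1
  · obtain ⟨y, hye, hyΦ⟩ := hex
    right
    rw [← card_filter_comp_eq_two e h2 z]
    congr 1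
    ext φ
    simp only [Finset.mem_filter, Finset.mem_univ, true_and]
    exact ⟨fun h => h.1, fun h => ⟨h, (hz y φ hye h).1 hyΦ⟩⟩
  · left
    rw [Finset.card_eq_zero, Finset.filter_eq_empty_iff]
    intro φ _ h
    exact hex ⟨φ, h.1, h.2⟩

/-- **A SPLIT place has signature `1`**: if the two extensions of `z` lie on different sides of `Φ` then exactly one of
them belongs to `Φ`. [cite: Shimura1998, §18.1] -/
theorem card_filter_comp_mem_of_split (e : k →+* K) (h2 : finrank ℚ K = 2 * finrank ℚ k) (Φ : CMType K)
    {z : k →+* ℂ} (hz : ¬ ∀ y y' : K →+* ℂ, y.comp e = z → y'.comp e = z → (y ∈ Φ.1 ↔ y' ∈ Φ.1)) :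
    (Finset.univ.filter fun φ : K →+* ℂ => φ.comp e = z ∧ φ ∈ Φ.1).card = 1 := by
  -- one extension inside, one outside; call them `a ∈ Φ`, `b ∉ Φ`
  obtain ⟨a, b, hae, hbe, haΦ, hbΦ⟩ : ∃ a b : K →+* ℂ, a.comp e = z ∧ b.comp e = z ∧ a ∈ Φ.1 ∧ b ∉ Φ.1 := by
    by_contra hnone
    refine hz fun y y' hye hy'e => ⟨fun hy => ?_, fun hy' => ?_⟩
    · by_contra hy'
      exact hnone ⟨y, y', hye, hy'e, hy, hy'⟩
    · by_contra hy
      exact hnone ⟨y', y, hy'e, hye, hy', hy⟩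
  have hab : a ≠ b := fun h => hbΦ (h ▸ haΦ)
  -- the fibre is `{a, b}`
  have hfib : (Finset.univ.filter fun φ : K →+* ℂ => φ.comp e = z) = {a, b} := by
    refine (Finset.eq_of_subset_of_card_le (fun φ hφ => ?_) ?_).symm
    · simp only [Finset.mem_insert, Finset.mem_singleton] at hφ
      rcases hφ with rfl | rfl
      · exact Finset.mem_filter.2 ⟨Finset.mem_univ _, hae⟩
      · exact Finset.mem_filter.2 ⟨Finset.mem_univ _, hbe⟩
    · rw [card_filter_comp_eq_two e h2 z, Finset.card_pair hab]
  have hsub : (Finset.univ.filter fun φ : K →+* ℂ => φ.comp e = z ∧ φ ∈ Φ.1) = {a} := by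
    ext φ
    simp only [Finset.mem_filter, Finset.mem_univ, true_and, Finset.mem_singleton]
    constructor
    · rintro ⟨hφe, hφΦ⟩
      have hmem : φ ∈ (Finset.univ.filter fun φ : K →+* ℂ => φ.comp e = z) :=
        Finset.mem_filter.2 ⟨Finset.mem_univ _, hφe⟩
      rw [hfib, Finset.mem_insert, Finset.mem_singleton] at hmem
      rcases hmem with rfl | rfl
      · rfl
      · exact absurd hφΦ hbΦ
    · rintro rfl
      exact ⟨hae, haΦ⟩
  rw [hsub, Finset.card_singleton]

omit [NumberField k] [NumberField K] in
/-- Conjugating an extension conjugates the place below: `φ̄ ∘ e = \overline{φ ∘ e}`. [folklore] -/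
theorem conj_smul_comp (φ : K →+* ℂ) (e : k →+* K) :
    ((starRingAut : ℂ ≃+* ℂ) • φ).comp e = (starRingAut : ℂ ≃+* ℂ) • φ.comp e := rfl

variable [IsCMField K]

/-- **The conjugate of an unsplit place is unsplit, with the opposite signature**: if both extensions of `z` agree on
`Φ` then so do both extensions of `z̄`, and `#{φ ∈ Φ | φ ∘ e = z̄} = 2 − #{φ ∈ Φ | φ ∘ e = z}` (`φ ∈ Φ ↔ φ̄ ∉ Φ`).
[cite: Shimura1998, §18.1] -/
theorem card_filter_comp_mem_conj_of_unsplit (e : k →+* K) (h2 : finrank ℚ K = 2 * finrank ℚ k) (Φ : CMType K)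
    {z : k →+* ℂ} (hz : ∀ y y' : K →+* ℂ, y.comp e = z → y'.comp e = z → (y ∈ Φ.1 ↔ y' ∈ Φ.1)) :
    (Finset.univ.filter fun φ : K →+* ℂ => φ.comp e = (starRingAut : ℂ ≃+* ℂ) • z ∧ φ ∈ Φ.1).card =
      2 - (Finset.univ.filter fun φ : K →+* ℂ => φ.comp e = z ∧ φ ∈ Φ.1).card := by
  have hCM := isCMTypeWith_conj Φ
  -- lifting a `φ` over `z̄` to `φ̄` over `z`
  have hover : ∀ φ : K →+* ℂ, φ.comp e = (starRingAut : ℂ ≃+* ℂ) • z →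
      ((starRingAut : ℂ ≃+* ℂ) • φ).comp e = z := fun φ hφ => by
    rw [conj_smul_comp, hφ, conj_smul_eq_conjugate, conj_smul_eq_conjugate]
    exact ComplexEmbedding.involutive_conjugate k z
  rcases card_filter_comp_mem_of_unsplit e h2 Φ hz with h0 | h2'
  · -- nothing over `z` in `Φ`: everything over `z̄` is in `Φ`
    rw [h0]
    have hall : (Finset.univ.filter fun φ : K →+* ℂ => φ.comp e = (starRingAut : ℂ ≃+* ℂ) • z ∧ φ ∈ Φ.1) =
        Finset.univ.filter fun φ : K →+* ℂ => φ.comp e = (starRingAut : ℂ ≃+* ℂ) • z := by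
      ext φ
      simp only [Finset.mem_filter, Finset.mem_univ, true_and]
      refine ⟨fun h => h.1, fun h => ⟨h, ?_⟩⟩
      by_contra hφ
      have h1 : (starRingAut : ℂ ≃+* ℂ) • φ ∈ Φ.1 := (hCM.rho_smul_mem_iff φ).2 hφ
      have hmem : (starRingAut : ℂ ≃+* ℂ) • φ ∈
          (Finset.univ.filter fun ψ : K →+* ℂ => ψ.comp e = z ∧ ψ ∈ Φ.1) :=
        Finset.mem_filter.2 ⟨Finset.mem_univ _, hover φ h, h1⟩
      rw [Finset.card_eq_zero.1 h0] at hmem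
      exact absurd hmem (Finset.notMem_empty _)
    rw [hall, card_filter_comp_eq_two e h2]
  · -- everything over `z` in `Φ`: nothing over `z̄` is in `Φ`
    rw [h2', Nat.sub_self, Finset.card_eq_zero, Finset.filter_eq_empty_iff]
    rintro φ - ⟨hφe, hφΦ⟩
    have hfull : (Finset.univ.filter fun ψ : K →+* ℂ => ψ.comp e = z ∧ ψ ∈ Φ.1) =
        Finset.univ.filter fun ψ : K →+* ℂ => ψ.comp e = z :=
      Finset.eq_of_subset_of_card_le (Finset.monotone_filter_right _ fun ψ _ h => h.1)
        (by rw [card_filter_comp_eq_two e h2 z, h2'])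
    have hmem : (starRingAut : ℂ ≃+* ℂ) • φ ∈ (Finset.univ.filter fun ψ : K →+* ℂ => ψ.comp e = z) :=
      Finset.mem_filter.2 ⟨Finset.mem_univ _, hover φ hφe⟩
    rw [← hfull, Finset.mem_filter] at hmem
    exact (hCM.rho_smul_mem_iff φ).1 hmem.2.2 hφΦ

end QuadraticStep

/-! ### §2 A common unsplit place makes the pair degenerate -/

section Family

variable {I : Type} {K : I → Type} [∀ i, Field (K i)] [∀ i, NumberField (K i)] [∀ i, IsCMField (K i)] [Fintype I]
  [Nonempty I]
variable {k : Type} [Field k] [NumberField k]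

omit [Fintype I] [Nonempty I] in
/-- **The shadows of two types with ONE COMMON unsplit conjugate pair are parallel and non-zero.**  With `z₀` unsplit
for both `Φ_{i₀}` (along `e₀`) and `Φ_{i₁}` (along `e₁`) and every place outside `{z₀, z̄₀}` split for both, the shadows
`c_k = 2 n_k − 2` are `±2(δ_{z₀} − δ_{z̄₀})`, hence `c₀ = q c₁` with `q = c₀(z₀) c₁(z₀)/4 = ±1`, and `c₀(z₀) ≠ 0`.
[cite: Gordon1999HodgeAVSurvey, 9.4.3] [cite: Shimura1998, §18.1] -/
theorem shadows_parallel_of_common_unsplit_place {i₀ i₁ : I} (e₀ : k →+* K i₀) (e₁ : k →+* K i₁)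
    (h2₀ : finrank ℚ (K i₀) = 2 * finrank ℚ k) (h2₁ : finrank ℚ (K i₁) = 2 * finrank ℚ k) (Φ : ∀ i, CMType (K i))
    {z₀ : k →+* ℂ}
    (hu₀ : ∀ y y' : K i₀ →+* ℂ, y.comp e₀ = z₀ → y'.comp e₀ = z₀ → (y ∈ (Φ i₀).1 ↔ y' ∈ (Φ i₀).1))
    (hu₁ : ∀ y y' : K i₁ →+* ℂ, y.comp e₁ = z₀ → y'.comp e₁ = z₀ → (y ∈ (Φ i₁).1 ↔ y' ∈ (Φ i₁).1))
    (hs₀ : ∀ z : k →+* ℂ, z ≠ z₀ → z ≠ (starRingAut : ℂ ≃+* ℂ) • z₀ →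
      ¬ ∀ y y' : K i₀ →+* ℂ, y.comp e₀ = z → y'.comp e₀ = z → (y ∈ (Φ i₀).1 ↔ y' ∈ (Φ i₀).1))
    (hs₁ : ∀ z : k →+* ℂ, z ≠ z₀ → z ≠ (starRingAut : ℂ ≃+* ℂ) • z₀ →
      ¬ ∀ y y' : K i₁ →+* ℂ, y.comp e₁ = z → y'.comp e₁ = z → (y ∈ (Φ i₁).1 ↔ y' ∈ (Φ i₁).1)) :
    (∀ z : k →+* ℂ,
      2 * ((Finset.univ.filter fun φ : K i₀ →+* ℂ => φ.comp e₀ = z ∧ φ ∈ (Φ i₀).1).card : ℚ) -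
          ((Finset.univ.filter fun φ : K i₀ →+* ℂ => φ.comp e₀ = z).card : ℚ) =
        ((2 * ((Finset.univ.filter fun φ : K i₀ →+* ℂ => φ.comp e₀ = z₀ ∧ φ ∈ (Φ i₀).1).card : ℚ) - 2) *
            (2 * ((Finset.univ.filter fun φ : K i₁ →+* ℂ => φ.comp e₁ = z₀ ∧ φ ∈ (Φ i₁).1).card : ℚ) - 2) / 4) *
          (2 * ((Finset.univ.filter fun φ : K i₁ →+* ℂ => φ.comp e₁ = z ∧ φ ∈ (Φ i₁).1).card : ℚ) -
            ((Finset.univ.filter fun φ : K i₁ →+* ℂ => φ.comp e₁ = z).card : ℚ))) ∧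
    2 * (Finset.univ.filter fun φ : K i₀ →+* ℂ => φ.comp e₀ = z₀ ∧ φ ∈ (Φ i₀).1).card ≠
      (Finset.univ.filter fun φ : K i₀ →+* ℂ => φ.comp e₀ = z₀).card := by
  -- the four signatures at `z₀`, `z̄₀`
  have hn₀ := card_filter_comp_mem_of_unsplit e₀ h2₀ (Φ i₀) hu₀
  have hn₁ := card_filter_comp_mem_of_unsplit e₁ h2₁ (Φ i₁) hu₁
  have hc₀ := card_filter_comp_mem_conj_of_unsplit e₀ h2₀ (Φ i₀) hu₀
  have hc₁ := card_filter_comp_mem_conj_of_unsplit e₁ h2₁ (Φ i₁) hu₁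
  refine ⟨fun z => ?_, ?_⟩
  · rw [card_filter_comp_eq_two e₀ h2₀ z, card_filter_comp_eq_two e₁ h2₁ z]
    by_cases hz : z = z₀
    · subst hz
      rcases hn₀ with h | h <;> rcases hn₁ with h' | h' <;> rw [h, h'] <;> norm_num
    · by_cases hz' : z = (starRingAut : ℂ ≃+* ℂ) • z₀
      · subst hz'
        rw [hc₀, hc₁]
        rcases hn₀ with h | h <;> rcases hn₁ with h' | h' <;> rw [h, h'] <;> norm_num
      · rw [card_filter_comp_mem_of_split e₀ h2₀ (Φ i₀) (hs₀ z hz hz'),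
          card_filter_comp_mem_of_split e₁ h2₁ (Φ i₁) (hs₁ z hz hz')]
        norm_num
  · rw [card_filter_comp_eq_two e₀ h2₀ z₀]
    rcases hn₀ with h | h <;> rw [h] <;> norm_num

/-- **A common unsplit place makes the rank non-additive**: `K_{i₀}`, `K_{i₁}` quadratic over a common `k`, `z₀`
unsplit for both types, all places outside `{z₀, z̄₀}` split for both ⟹ `cmFamilyRank Φ + |I| < Σ_i cmTypeRank Φ_i + 1`.
[cite: Gordon1999HodgeAVSurvey, 7.5 and 9.4.3] -/
theorem cmFamilyRank_add_card_lt_of_common_unsplit_place {i₀ i₁ : I} (h01 : i₀ ≠ i₁) (e₀ : k →+* K i₀)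
    (e₁ : k →+* K i₁) (h2₀ : finrank ℚ (K i₀) = 2 * finrank ℚ k) (h2₁ : finrank ℚ (K i₁) = 2 * finrank ℚ k)
    (Φ : ∀ i, CMType (K i)) {z₀ : k →+* ℂ}
    (hu₀ : ∀ y y' : K i₀ →+* ℂ, y.comp e₀ = z₀ → y'.comp e₀ = z₀ → (y ∈ (Φ i₀).1 ↔ y' ∈ (Φ i₀).1))
    (hu₁ : ∀ y y' : K i₁ →+* ℂ, y.comp e₁ = z₀ → y'.comp e₁ = z₀ → (y ∈ (Φ i₁).1 ↔ y' ∈ (Φ i₁).1))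
    (hs₀ : ∀ z : k →+* ℂ, z ≠ z₀ → z ≠ (starRingAut : ℂ ≃+* ℂ) • z₀ →
      ¬ ∀ y y' : K i₀ →+* ℂ, y.comp e₀ = z → y'.comp e₀ = z → (y ∈ (Φ i₀).1 ↔ y' ∈ (Φ i₀).1))
    (hs₁ : ∀ z : k →+* ℂ, z ≠ z₀ → z ≠ (starRingAut : ℂ ≃+* ℂ) • z₀ →
      ¬ ∀ y y' : K i₁ →+* ℂ, y.comp e₁ = z → y'.comp e₁ = z → (y ∈ (Φ i₁).1 ↔ y' ∈ (Φ i₁).1)) :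
    CMAlgebra.cmFamilyRank Φ + Fintype.card I < (∑ i, cmTypeRank (Φ i)) + 1 := by
  obtain ⟨hpar, hz₀⟩ := shadows_parallel_of_common_unsplit_place e₀ e₁ h2₀ h2₁ Φ hu₀ hu₁ hs₀ hs₁
  exact cmFamilyRank_add_card_lt_of_parallel_signatures h01 e₀ e₁ Φ _ hpar hz₀

/-- **A common unsplit place makes the family DEGENERATE** (`¬ IsNondegenerateFamily Φ`), whatever the other slots and
even if both members are nondegenerate. [cite: Gordon1999HodgeAVSurvey, 7.5–7.7 and 9.4.3] -/
theorem not_isNondegenerateFamily_of_common_unsplit_place {i₀ i₁ : I} (h01 : i₀ ≠ i₁) (e₀ : k →+* K i₀)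
    (e₁ : k →+* K i₁) (h2₀ : finrank ℚ (K i₀) = 2 * finrank ℚ k) (h2₁ : finrank ℚ (K i₁) = 2 * finrank ℚ k)
    (Φ : ∀ i, CMType (K i)) {z₀ : k →+* ℂ}
    (hu₀ : ∀ y y' : K i₀ →+* ℂ, y.comp e₀ = z₀ → y'.comp e₀ = z₀ → (y ∈ (Φ i₀).1 ↔ y' ∈ (Φ i₀).1))
    (hu₁ : ∀ y y' : K i₁ →+* ℂ, y.comp e₁ = z₀ → y'.comp e₁ = z₀ → (y ∈ (Φ i₁).1 ↔ y' ∈ (Φ i₁).1))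
    (hs₀ : ∀ z : k →+* ℂ, z ≠ z₀ → z ≠ (starRingAut : ℂ ≃+* ℂ) • z₀ →
      ¬ ∀ y y' : K i₀ →+* ℂ, y.comp e₀ = z → y'.comp e₀ = z → (y ∈ (Φ i₀).1 ↔ y' ∈ (Φ i₀).1))
    (hs₁ : ∀ z : k →+* ℂ, z ≠ z₀ → z ≠ (starRingAut : ℂ ≃+* ℂ) • z₀ →
      ¬ ∀ y y' : K i₁ →+* ℂ, y.comp e₁ = z → y'.comp e₁ = z → (y ∈ (Φ i₁).1 ↔ y' ∈ (Φ i₁).1)) :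
    ¬ CMAlgebra.IsNondegenerateFamily Φ :=
  not_isNondegenerateFamily_of_cmFamilyRank_add_card_lt Φ
    (cmFamilyRank_add_card_lt_of_common_unsplit_place h01 e₀ e₁ h2₀ h2₁ Φ hu₀ hu₁ hs₀ hs₁)

/-- **… and the two reflex fields do not meet in a totally real field** (two-slot family): no element of the
subgroup of `Aut(ℂ)` generated by the two type stabilisers is complex conjugation on `Hom(K_{i₀}, ℂ)`.
[cite: Shimura1998, §8.3] [cite: Gordon1999HodgeAVSurvey, §3 Theorem (proof)] -/
theorem not_exists_smul_eq_conj_of_common_unsplit_place {i₀ i₁ : I} (hI : ∀ j, j = i₀ ∨ j = i₁) (h01 : i₀ ≠ i₁)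
    (e₀ : k →+* K i₀) (e₁ : k →+* K i₁) (h2₀ : finrank ℚ (K i₀) = 2 * finrank ℚ k)
    (h2₁ : finrank ℚ (K i₁) = 2 * finrank ℚ k) (Φ : ∀ i, CMType (K i)) {z₀ : k →+* ℂ}
    (hu₀ : ∀ y y' : K i₀ →+* ℂ, y.comp e₀ = z₀ → y'.comp e₀ = z₀ → (y ∈ (Φ i₀).1 ↔ y' ∈ (Φ i₀).1))
    (hu₁ : ∀ y y' : K i₁ →+* ℂ, y.comp e₁ = z₀ → y'.comp e₁ = z₀ → (y ∈ (Φ i₁).1 ↔ y' ∈ (Φ i₁).1))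
    (hs₀ : ∀ z : k →+* ℂ, z ≠ z₀ → z ≠ (starRingAut : ℂ ≃+* ℂ) • z₀ →
      ¬ ∀ y y' : K i₀ →+* ℂ, y.comp e₀ = z → y'.comp e₀ = z → (y ∈ (Φ i₀).1 ↔ y' ∈ (Φ i₀).1))
    (hs₁ : ∀ z : k →+* ℂ, z ≠ z₀ → z ≠ (starRingAut : ℂ ≃+* ℂ) • z₀ →
      ¬ ∀ y y' : K i₁ →+* ℂ, y.comp e₁ = z → y'.comp e₁ = z → (y ∈ (Φ i₁).1 ↔ y' ∈ (Φ i₁).1)) :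
    ¬ ∃ g ∈ Subgroup.closure
        ({s : ℂ ≃+* ℂ | ∀ x : K i₀ →+* ℂ, s • x ∈ (Φ i₀).1 ↔ x ∈ (Φ i₀).1} ∪
          {s : ℂ ≃+* ℂ | ∀ y : K i₁ →+* ℂ, s • y ∈ (Φ i₁).1 ↔ y ∈ (Φ i₁).1}),
      ∀ x : K i₀ →+* ℂ, g • x = (starRingAut : ℂ ≃+* ℂ) • x := by
  obtain ⟨hpar, hz₀⟩ := shadows_parallel_of_common_unsplit_place e₀ e₁ h2₀ h2₁ Φ hu₀ hu₁ hs₀ hs₁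
  exact not_exists_smul_eq_conj_of_parallel_signatures hI h01 e₀ e₁ Φ _ hpar hz₀

end Family

/-! ### §3 On abelian varieties: exceptional classes; the `(4,4)` cell -/

section Varieties

variable {I : Type} {K : I → Type} [∀ i, Field (K i)] [∀ i, NumberField (K i)] [∀ i, IsCMField (K i)] [Fintype I]
  [Nonempty I] {Φ : ∀ i, CMType (K i)}
variable {A : I → AbelianVariety ℂ} {ι : ∀ i, 𝓞 (K i) →+* End (A i)}
  {θ : ∀ i, K i →+* Module.End ℂ (complexBetti (A i).X 1)}
variable {k : Type} [Field k] [NumberField k]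

/-- **SIMPLE, NON-ISOGENOUS CM abelian varieties with CM fields quadratic over a common subfield `k` and types unsplit
over a COMMON place of `k` (all other places split) carry an exceptional Hodge class on some `A_{i₀}^a × A_{i₁}^b`**
(a rational `(m,m)`-class outside `Dᵐ ⊗ ℂ`; not claimed algebraic or not). [cite: Gordon1999HodgeAVSurvey, 7.4–7.7 and 9.4.3] -/
theorem exists_exceptional_prod_of_isSimple_of_common_unsplit_place {i₀ i₁ : I} (h01 : i₀ ≠ i₁)
    (e₀ : k →+* K i₀) (e₁ : k →+* K i₁) (h2₀ : finrank ℚ (K i₀) = 2 * finrank ℚ k)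
    (h2₁ : finrank ℚ (K i₁) = 2 * finrank ℚ k) {z₀ : k →+* ℂ}
    (hu₀ : ∀ y y' : K i₀ →+* ℂ, y.comp e₀ = z₀ → y'.comp e₀ = z₀ → (y ∈ (Φ i₀).1 ↔ y' ∈ (Φ i₀).1))
    (hu₁ : ∀ y y' : K i₁ →+* ℂ, y.comp e₁ = z₀ → y'.comp e₁ = z₀ → (y ∈ (Φ i₁).1 ↔ y' ∈ (Φ i₁).1))
    (hs₀ : ∀ z : k →+* ℂ, z ≠ z₀ → z ≠ (starRingAut : ℂ ≃+* ℂ) • z₀ →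
      ¬ ∀ y y' : K i₀ →+* ℂ, y.comp e₀ = z → y'.comp e₀ = z → (y ∈ (Φ i₀).1 ↔ y' ∈ (Φ i₀).1))
    (hs₁ : ∀ z : k →+* ℂ, z ≠ z₀ → z ≠ (starRingAut : ℂ ≃+* ℂ) • z₀ →
      ¬ ∀ y y' : K i₁ →+* ℂ, y.comp e₁ = z → y'.comp e₁ = z → (y ∈ (Φ i₁).1 ↔ y' ∈ (Φ i₁).1))
    (hA : ∀ i, IsCMTypeRealisation (Φ i) (A i) (ι i) (θ i)) (hs : ∀ i, (A i).IsSimple)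
    (hniso : ∀ i j, i ≠ j → ¬ AbelianVariety.IsIsogenous (A i) (A j)) :
    ∃ (N : ℕ) (π : Fin N → I) (m : ℕ) (c : complexBetti (⨁ fun j : Fin N => A (π j)).X (2 * m)),
      IsRationalClass c ∧
      IsOfHodgeType (⨁ fun j : Fin N => A (π j)).dim (⨁ fun j : Fin N => A (π j)).X (2 * m) m m c ∧
      c ∉ divisorClassesSpan (⨁ fun j : Fin N => A (π j)).X (⨁ fun j : Fin N => A (π j)).dim m := by
  obtain ⟨hpar, hz₀⟩ := shadows_parallel_of_common_unsplit_place e₀ e₁ h2₀ h2₁ Φ hu₀ hu₁ hs₀ hs₁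
  exact exists_exceptional_prod_of_isSimple_of_parallel_signatures h01 e₀ e₁ _ hpar hz₀ hA hs hniso

/-- **The `(4,4)` cell: two simple CM abelian FOURFOLDS, not isogenous, whose (octic) CM fields contain a common QUARTIC
CM field `k`, with types unsplit over the same place of `k` and split over the other conjugate pair, carry an exceptional
Hodge class on some `F₀^a × F₁^b`.**  (For `k` non-Galois this is decided by the types, not the fields; when the unsplit
pairs differ and the reflex fields meet in a totally real field the pair is additive, `ReflexFieldsMeetRealCMHodge`.)
[cite: Gordon1999HodgeAVSurvey, 7.4–7.7 and 9.4.3] [cite: MoonenZarhin1999LowDim, "Hodge groups of simple abelian surfaces of CM-type"] -/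
theorem exists_exceptional_prod_fourfolds_of_common_unsplit_place {i₀ i₁ : I} (h01 : i₀ ≠ i₁) (hk : finrank ℚ k = 4)
    (e₀ : k →+* K i₀) (e₁ : k →+* K i₁) (hd₀ : (A i₀).dim = 4) (hd₁ : (A i₁).dim = 4) {z₀ : k →+* ℂ}
    (hu₀ : ∀ y y' : K i₀ →+* ℂ, y.comp e₀ = z₀ → y'.comp e₀ = z₀ → (y ∈ (Φ i₀).1 ↔ y' ∈ (Φ i₀).1))
    (hu₁ : ∀ y y' : K i₁ →+* ℂ, y.comp e₁ = z₀ → y'.comp e₁ = z₀ → (y ∈ (Φ i₁).1 ↔ y' ∈ (Φ i₁).1))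
    (hs₀ : ∀ z : k →+* ℂ, z ≠ z₀ → z ≠ (starRingAut : ℂ ≃+* ℂ) • z₀ →
      ¬ ∀ y y' : K i₀ →+* ℂ, y.comp e₀ = z → y'.comp e₀ = z → (y ∈ (Φ i₀).1 ↔ y' ∈ (Φ i₀).1))
    (hs₁ : ∀ z : k →+* ℂ, z ≠ z₀ → z ≠ (starRingAut : ℂ ≃+* ℂ) • z₀ →
      ¬ ∀ y y' : K i₁ →+* ℂ, y.comp e₁ = z → y'.comp e₁ = z → (y ∈ (Φ i₁).1 ↔ y' ∈ (Φ i₁).1))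
    (hA : ∀ i, IsCMTypeRealisation (Φ i) (A i) (ι i) (θ i)) (hs : ∀ i, (A i).IsSimple)
    (hniso : ∀ i j, i ≠ j → ¬ AbelianVariety.IsIsogenous (A i) (A j)) :
    ∃ (N : ℕ) (π : Fin N → I) (m : ℕ) (c : complexBetti (⨁ fun j : Fin N => A (π j)).X (2 * m)),
      IsRationalClass c ∧
      IsOfHodgeType (⨁ fun j : Fin N => A (π j)).dim (⨁ fun j : Fin N => A (π j)).X (2 * m) m m c ∧
      c ∉ divisorClassesSpan (⨁ fun j : Fin N => A (π j)).X (⨁ fun j : Fin N => A (π j)).dim m := by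
  have h8₀ : finrank ℚ (K i₀) = 2 * finrank ℚ k := by
    rw [finrank_eq_two_mul_dim_of_isCMTypeRealisation (hA i₀), hd₀, hk]
  have h8₁ : finrank ℚ (K i₁) = 2 * finrank ℚ k := by
    rw [finrank_eq_two_mul_dim_of_isCMTypeRealisation (hA i₁), hd₁, hk]
  exact exists_exceptional_prod_of_isSimple_of_common_unsplit_place h01 e₀ e₁ h8₀ h8₁ hu₀ hu₁ hs₀ hs₁ hA hs hniso

/-- **`B• = D•` fails on some `F₀^a × F₁^b`** for two simple non-isogenous CM fourfolds over a common quartic CM field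
with a common unsplit place. [cite: Gordon1999HodgeAVSurvey, 7.5 and 7.6.1] -/
theorem not_forall_prod_hodgeClassSpan_eq_fourfolds_of_common_unsplit_place {i₀ i₁ : I} (h01 : i₀ ≠ i₁)
    (hk : finrank ℚ k = 4) (e₀ : k →+* K i₀) (e₁ : k →+* K i₁) (hd₀ : (A i₀).dim = 4) (hd₁ : (A i₁).dim = 4)
    {z₀ : k →+* ℂ}
    (hu₀ : ∀ y y' : K i₀ →+* ℂ, y.comp e₀ = z₀ → y'.comp e₀ = z₀ → (y ∈ (Φ i₀).1 ↔ y' ∈ (Φ i₀).1))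
    (hu₁ : ∀ y y' : K i₁ →+* ℂ, y.comp e₁ = z₀ → y'.comp e₁ = z₀ → (y ∈ (Φ i₁).1 ↔ y' ∈ (Φ i₁).1))
    (hs₀ : ∀ z : k →+* ℂ, z ≠ z₀ → z ≠ (starRingAut : ℂ ≃+* ℂ) • z₀ →
      ¬ ∀ y y' : K i₀ →+* ℂ, y.comp e₀ = z → y'.comp e₀ = z → (y ∈ (Φ i₀).1 ↔ y' ∈ (Φ i₀).1))
    (hs₁ : ∀ z : k →+* ℂ, z ≠ z₀ → z ≠ (starRingAut : ℂ ≃+* ℂ) • z₀ →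
      ¬ ∀ y y' : K i₁ →+* ℂ, y.comp e₁ = z → y'.comp e₁ = z → (y ∈ (Φ i₁).1 ↔ y' ∈ (Φ i₁).1))
    (hA : ∀ i, IsCMTypeRealisation (Φ i) (A i) (ι i) (θ i)) (hs : ∀ i, (A i).IsSimple)
    (hniso : ∀ i j, i ≠ j → ¬ AbelianVariety.IsIsogenous (A i) (A j)) :
    ¬ ∀ (N : ℕ) (π : Fin N → I) (m : ℕ),
      hodgeClassSpan (⨁ fun j : Fin N => A (π j)).dim (⨁ fun j : Fin N => A (π j)).X m =
        divisorClassesSpan (⨁ fun j : Fin N => A (π j)).X (⨁ fun j : Fin N => A (π j)).dim m := fun h => by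
  have h8₀ : finrank ℚ (K i₀) = 2 * finrank ℚ k := by
    rw [finrank_eq_two_mul_dim_of_isCMTypeRealisation (hA i₀), hd₀, hk]
  have h8₁ : finrank ℚ (K i₁) = 2 * finrank ℚ k := by
    rw [finrank_eq_two_mul_dim_of_isCMTypeRealisation (hA i₁), hd₁, hk]
  exact not_isNondegenerateFamily_of_common_unsplit_place h01 e₀ e₁ h8₀ h8₁ Φ hu₀ hu₁ hs₀ hs₁
    ((CMAlgebra.isNondegenerateFamily_iff_forall_prod_hodgeClassSpan_eq
      (CMAlgebra.isSeparatingFamily_of_isSimple_of_pairwise_not_isIsogenous hA hs hniso) hA).2 h)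

end Varieties

end Summit.HodgeConjecture.CorCM

end
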